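import Literature.NumberTheory.Rogawski1990.ArchChartOrbGTensorOverPlacesLoc   -- ★ (F1′) p852055 (this seat): `chartOrbG_eq_prod_chartOrbGLoc_mul_of_tensor`; brings ★ (F), ★ `ArchInnerFormChartOrbLocal` (`chartOrbGLoc`)
import Literature.NumberTheory.Rogawski1990.ArchBouazizClassMultiplierG         -- ★ F4 p851978 (LH7-p01): `bzClassMapG_slotPerm`, `continuous_bzClassG`; brings F0 `bzClassG`, `bzClassG_conj`, `bzClassG_gprimeTorus`, ★ `orbFamGExt`
import HarnessLib

/-!
# EP ASSEMBLY, the `β`-side tensor reading «hβ» of the core identity: the plain chart reading of the per-ball test function at every partner point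
# (Rogawski 1990 §4.1, §8.2, §14.2; Shelstad 1979 Lemma 4.2; Borel–Jacquet 1979 §4.1)

Topic `NumberTheory/Rogawski1990`; namespace `Literature.NumberTheory.Rogawski1990`.  THEOREMS ONLY (no `def`, no instance, no notation, no axiom, no named fact, no `sorry`);
lane `--kind proof --supports stmt-HodgeConjecture-24833`.  Cell `pub/hodgecm-mathlib`, crux H413 (`stmt-HodgeConjecture-24833`), road «N8-INNER» ROAD B «EP road» (owner∕dealer
LH2-plan (g1)), brick (12′) «EP ASSEMBLY = H-S4′», file E3a (pen LH7-p04 (g8), `CENSUS-E3a.v1.LH7p04g8.md` 748a715383396d15 §3): this file is the CO-SLICE «hβ» — the `β`-side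
per-ball TENSOR READING binder `hβ` of ★ E3-CORE p852223 `stableSumG_eq_inv_pow_mul_of_readings` (dealer 17:22:05Z «hβ → F0P2-p02 (g21)»; sigsheet
`F0/P2/p02/g21/hb/SIGSHEET-E3a-hbeta.v1.F0P2p02g21.md`).  Author F0P2-p02 (g21).  Count-neutral: the analytic inputs are ★ (F1′) and ★ F4; nothing here closes an organ.

THE MATHEMATICS.  Fix a frame `β` (`β_i ≠ 0`), an admissible label `S`, a block predicate `p` on the complex places AVOIDING the label (`p w → w ∉ S` — E3a: `p = (· ∈ D)`, `D` the
`α`-definite places), a `G`-regular coordinate `c`, and the per-ball test function of the EP assembly in the shape of ★ §2(7) `archSmooth_prod_classMul_tensor_mul_coupling`: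
`f(k) = (Π_{w : p} mcl_w(cl_w k) · f_w(k_w)) · G(cl_p k, k_{¬p})`, where `cl_w k = bzClassG L β k w ∈ ℂ³` is the place class (F0), `f_w` one-place bumps, `mcl_w` class weights and `G`
the coupling factor (it sees the `p`-block ONLY through its classes).  Then at every partner point `ρ·c` (`ρ ∈ partnerPerms S`) the plain chart reading
`Φ_β(ρ·c) := orbFamGExt β ν′ f S (ρ·c) ∕ archRG S (ρ·c)` (= `chartOrbG β ν′ S f (ρ·c)` there, ★ `orbFamGExt_of_mem_regG_of_admissible`) FACTORISES:
`Φ_β(ρ·c) = (Π_{w : p} mcl_w(cl_w(c)) · chartOrbGLoc_w(f_w)(c_w ∘ ρ_w)) · R_β(ρ|_{¬p})`, `cl_w(c) := bzClassMapG S c w`, with the `¬p`-block reading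
`R_β(ρ₂) = (Π_{w′ : ¬p} t_{w′}(B′_{w′})) · ∫_{Π_{¬p} U_{w′}⧸T′_{w′}} G(cl_p(c), (ḃ_{w′} γ_{w′}(c_{w′} ∘ ρ₂ w′) ḃ_{w′}⁻¹)_{w′}) d(⊗ ν′_{w′}∕t_{w′})` — EXACTLY the binder `hβ` of ★ E3-CORE with
`m w := mcl_w(cl_w(c))`, `g w := chartOrbGLoc_w(f_w)`, `R_β`.  Ingredients: ★ (F1′) `chartOrbG_eq_prod_chartOrbGLoc_mul_of_tensor` (the tensor splits, literal `chartOrbGLoc` factors at the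
`p`-places since they avoid `S`), whose invariance hypothesis `hu` holds for `u(k) = G(cl_p k, k_{¬p})` because the place class is conjugation invariant place by place (F0 `bzClassG_conj`
through the block embedding `Pi.mulSingle`); the one-place CLASS PULL-OUT `chartOrbGLoc_w((M ∘ cl_w) · f_w)(cw) = M(cl_w(γ_w(cw))) · chartOrbGLoc_w(f_w)(cw)` (local twin of ★ F4
`chartOrbG_classMul`); and the values of the classes on the orbit: `cl_w(γ(ρ·c)) = bzClassMapG S (ρ·c) w = bzClassMapG S c w` (F0 `bzClassG_gprimeTorus`, ★ F4 `bzClassMapG_slotPerm` —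
the partner relabellings do not move the stable class).  The classes therefore come out FROZEN at `bzClassMapG S c`: the pen needs no separate orbit-congruence call for `hβ`.
* §1 place classes through the block embedding: `bzClassG_congr_apply`, `bzClassG_symm_mulSingle_conj`, `bzClassG_symm_piEquiv_eq_mulSingle`, `bzClassG_symm_mulSingle_gprimeBlockAt`;
* §2 the one-place class pull-out `chartOrbGLoc_bzClassG_mul`;
* §3 **`orbFamGExt_div_archRG_slotPerm_eq_of_tensor`** — the «hβ» head.
HONEST LABEL: HC_CM is proved only modulo the 7 printed citations (2 remaining: hLiu418 = `stmt-HodgeConjecture-24832`, h413 = `stmt-HodgeConjecture-24833`) until rung 0 closes.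

## References
* [Rogawski1990] J. D. Rogawski, *Automorphic Representations of Unitary Groups in Three Variables*, Ann. of Math. Stud. 123 (1990), §4.1 (4.1.1) p. 39, §8.2 p. 122, §8.3 p. 124,
  §14.2 (14.2.1) pp. 232–233.
* [Shelstad1979] D. Shelstad, *Characters and inner forms of a quasi-split group over ℝ*, Compositio Math. 39 (1979), §4 pp. 22–26, Lemma 4.2 p. 23.
* [BorelJacquet1979] A. Borel, H. Jacquet, *Automorphic forms and automorphic representations*, Proc. Sympos. Pure Math. 33 (1979), part 1, §4.1 (tensor test functions).
* [Bouaziz1994IntegralesOrbitales] A. Bouaziz, *Intégrales orbitales sur les groupes de Lie réductifs*, Ann. Sci. ÉNS (4) 27 (1994), §2.3 p. 578, §5.1 p. 588 (class functions).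
-/

set_option autoImplicit false

noncomputable section

open MeasureTheory MeasureTheory.Measure NumberField NumberField.InfinitePlace Matrix Complex Topology
open Literature.MeasureTheory.Group Literature.NumberTheory.Automorphic Literature.NumberTheory.Automorphic.UnitaryGroup Literature.NumberTheory.Automorphic.ArchCartan
open scoped MatrixGroups Matrix Classical ENNReal NNReal

namespace Literature.NumberTheory.Rogawski1990

/-! ## §1 Place classes through the block embedding -/

section PlaceClass

variable (L : Type) [Field L] [NumberField L] [IsCMField L] (α : Fin 3 → L)

/-- The place class `bzClassG L α k w` depends on `k` only through its `w`-component. [cite: Rogawski1990, §3.6 p. 28] -/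
theorem bzClassG_congr_apply {k k' : ↥(arch (↥(maximalRealSubfield L)) L (IsCMField.complexConj L) 3 (Matrix.diagonal α))} {w : {w : InfinitePlace L // IsComplex w}}
    (h : archPiEquivCM 3 L (Matrix.diagonal α) k w = archPiEquivCM 3 L (Matrix.diagonal α) k' w) : bzClassG L α k w = bzClassG L α k' w := by
  rw [bzClassG_apply, bzClassG_apply, h]

/-- **The place class is conjugation invariant place by place**: through the block embedding `Pi.mulSingle w`, `cl_w(y x y⁻¹) = cl_w(x)` (F0 `bzClassG_conj`).
[cite: Bouaziz1994IntegralesOrbitales, §2.3 p. 578] -/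
theorem bzClassG_symm_mulSingle_conj (w : {w : InfinitePlace L // IsComplex w}) (y x : ↥(archLocal L 3 (Matrix.diagonal α) w)) :
    bzClassG L α ((archPiEquivCM 3 L (Matrix.diagonal α)).symm (Pi.mulSingle w (y * x * y⁻¹))) w =
      bzClassG L α ((archPiEquivCM 3 L (Matrix.diagonal α)).symm (Pi.mulSingle w x)) w := by
  rw [show (Pi.mulSingle w (y * x * y⁻¹) : ∀ w' : {w : InfinitePlace L // IsComplex w}, ↥(archLocal L 3 (Matrix.diagonal α) w')) =
      Pi.mulSingle w y * Pi.mulSingle w x * (Pi.mulSingle w y)⁻¹ by rw [Pi.mulSingle_mul, Pi.mulSingle_mul, Pi.mulSingle_inv], map_mul, map_mul, map_inv]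
  exact congrFun (bzClassG_conj L α _ _) w

/-- In the product coordinates `e⁻¹ ∘ (piEquivPiSubtypeProd … p)⁻¹`, the class at a `p`-place `w` is the class of the block embedding of the `w`-coordinate.
[cite: BorelJacquet1979, §4.1] -/
theorem bzClassG_symm_piEquiv_eq_mulSingle (p : {w : InfinitePlace L // IsComplex w} → Prop) [DecidablePred p]
    [∀ w : {w : InfinitePlace L // IsComplex w}, MeasurableSpace ↥(archLocal L 3 (Matrix.diagonal α) w)]
    (x : ∀ w : {w : {w : InfinitePlace L // IsComplex w} // p w}, ↥(archLocal L 3 (Matrix.diagonal α) w.1))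
    (y : ∀ w' : {w : {w : InfinitePlace L // IsComplex w} // ¬ p w}, ↥(archLocal L 3 (Matrix.diagonal α) w'.1)) (w : {w : {w : InfinitePlace L // IsComplex w} // p w}) :
    bzClassG L α ((archPiEquivCM 3 L (Matrix.diagonal α)).symm
        ((MeasurableEquiv.piEquivPiSubtypeProd (fun w : {w : InfinitePlace L // IsComplex w} => ↥(archLocal L 3 (Matrix.diagonal α) w)) p).symm (x, y))) w.1 =
      bzClassG L α ((archPiEquivCM 3 L (Matrix.diagonal α)).symm (Pi.mulSingle w.1 (x w))) w.1 := by
  refine bzClassG_congr_apply L α ?_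
  rw [ContinuousMulEquiv.apply_symm_apply, ContinuousMulEquiv.apply_symm_apply, Pi.mulSingle_eq_same]
  show (if h : p w.1 then x ⟨w.1, h⟩ else y ⟨w.1, h⟩) = x w
  rw [dif_pos w.2]

/-- **The class of a local chart point is the chart-level class datum**: `cl_w(gprimeBlockAt L α w S′ (c w)) = bzClassMapG S′ c w` on an admissible label (F0 `bzClassG_gprimeTorus` read at
the place `w`, ★ `archPiEquivCM_gprimeTorus`). [cite: Rogawski1990, §3.6 p. 28; §4.3 p. 42] -/
theorem bzClassG_symm_mulSingle_gprimeBlockAt {S' : Finset {w : InfinitePlace L // IsComplex w}} (hS' : ∀ w, w ∈ S' → w ∈ splitChartPlaces L α)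
    (c : {w : InfinitePlace L // IsComplex w} → Fin 3 → ℝ) (w : {w : InfinitePlace L // IsComplex w}) :
    bzClassG L α ((archPiEquivCM 3 L (Matrix.diagonal α)).symm (Pi.mulSingle w (gprimeBlockAt L α w S' (c w)))) w = bzClassMapG S' c w := by
  rw [← congrFun (bzClassG_gprimeTorus L α S' hS' c) w]
  refine bzClassG_congr_apply L α ?_
  rw [ContinuousMulEquiv.apply_symm_apply, Pi.mulSingle_eq_same, archPiEquivCM_gprimeTorus]
  rfl

end PlaceClass

/-! ## §2 The one-place class pull-out -/

section PullOut

variable (L : Type) [Field L] [NumberField L] [IsCMField L] (α : Fin 3 → L) (w : {w : InfinitePlace L // IsComplex w}) (S' : Finset {w : InfinitePlace L // IsComplex w})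
  [MeasurableSpace ↥(archLocal L 3 (Matrix.diagonal α) w)] [BorelSpace ↥(archLocal L 3 (Matrix.diagonal α) w)]
  (νw : Measure ↥(archLocal L 3 (Matrix.diagonal α) w)) [νw.IsHaarMeasure] [νw.IsMulRightInvariant]

/-- **ONE-PLACE CLASS PULL-OUT**: `chartOrbGLoc_w((M ∘ cl_w) · f)(cw) = M(cl_w(gprimeBlockAt cw)) · chartOrbGLoc_w(f)(cw)` at EVERY `cw` — the integrand on `U_w ⧸ T′_w` is
`M(cl_w(x γ x⁻¹)) f(x γ x⁻¹) = M(cl_w γ) f(x γ x⁻¹)` (★ `descConj_mk`, `bzClassG_symm_mulSingle_conj`); the local twin of ★ F4 `chartOrbG_classMul`.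
[cite: Bouaziz1994IntegralesOrbitales, §5.1 p. 588] [cite: Rogawski1990, §8.2 p. 122] -/
theorem chartOrbGLoc_bzClassG_mul (M : ℂ × ℂ × ℂ → ℂ) (f : ↥(archLocal L 3 (Matrix.diagonal α) w) → ℂ) (cw : Fin 3 → ℝ) :
    chartOrbGLoc L α w S' νw (fun x => M (bzClassG L α ((archPiEquivCM 3 L (Matrix.diagonal α)).symm (Pi.mulSingle w x)) w) * f x) cw =
      M (bzClassG L α ((archPiEquivCM 3 L (Matrix.diagonal α)).symm (Pi.mulSingle w (gprimeBlockAt L α w S' cw))) w) * chartOrbGLoc L α w S' νw f cw := by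
  rw [chartOrbGLoc_def, chartOrbGLoc_def]
  have hint : descConj (gprimeBlockAt L α w S' cw) (chartTorusGLoc L α w S') (forall_mem_chartTorusGLoc_comm L α w S' cw)
        (fun x : ↥(archLocal L 3 (Matrix.diagonal α) w) => M (bzClassG L α ((archPiEquivCM 3 L (Matrix.diagonal α)).symm (Pi.mulSingle w x)) w) * f x) =
      fun y => M (bzClassG L α ((archPiEquivCM 3 L (Matrix.diagonal α)).symm (Pi.mulSingle w (gprimeBlockAt L α w S' cw))) w) *
        descConj (gprimeBlockAt L α w S' cw) (chartTorusGLoc L α w S') (forall_mem_chartTorusGLoc_comm L α w S' cw) f y := by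
    funext y
    induction y using QuotientGroup.induction_on with
    | H g => rw [descConj_mk, descConj_mk, bzClassG_symm_mulSingle_conj]
  rw [hint, integral_const_mul]
  ring

end PullOut

/-! ## §3 The «hβ» reading -/

section HBeta

variable (L : Type) [Field L] [NumberField L] [IsCMField L] (β : Fin 3 → L) (S : Finset {w : InfinitePlace L // IsComplex w})
  [∀ w : {w : InfinitePlace L // IsComplex w}, MeasurableSpace ↥(archLocal L 3 (Matrix.diagonal β) w)]
  [∀ w : {w : InfinitePlace L // IsComplex w}, BorelSpace ↥(archLocal L 3 (Matrix.diagonal β) w)]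
  [∀ w : {w : InfinitePlace L // IsComplex w}, LocallyCompactSpace ↥(archLocal L 3 (Matrix.diagonal β) w)]
  [∀ w : {w : InfinitePlace L // IsComplex w}, SecondCountableTopology ↥(archLocal L 3 (Matrix.diagonal β) w)]
  (ν'w : ∀ w : {w : InfinitePlace L // IsComplex w}, Measure ↥(archLocal L 3 (Matrix.diagonal β) w)) [∀ w, (ν'w w).IsHaarMeasure] [∀ w, (ν'w w).IsMulRightInvariant]
  (p : {w : InfinitePlace L // IsComplex w} → Prop) [DecidablePred p]
  [Fintype {w : {w : InfinitePlace L // IsComplex w} // p w}] [Fintype {w : {w : InfinitePlace L // IsComplex w} // ¬ p w}]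
  [MeasurableSpace ↥(arch (↥(maximalRealSubfield L)) L (IsCMField.complexConj L) 3 (Matrix.diagonal β))]
  [BorelSpace ↥(arch (↥(maximalRealSubfield L)) L (IsCMField.complexConj L) 3 (Matrix.diagonal β))]
  [∀ w : {w : InfinitePlace L // IsComplex w}, MeasurableSpace (↥(archLocal L 3 (Matrix.diagonal β) w) ⧸ chartTorusGLoc L β w S)]
  [∀ w : {w : InfinitePlace L // IsComplex w}, BorelSpace (↥(archLocal L 3 (Matrix.diagonal β) w) ⧸ chartTorusGLoc L β w S)]
  (ν' : Measure ↥(arch (↥(maximalRealSubfield L)) L (IsCMField.complexConj L) 3 (Matrix.diagonal β))) [ν'.IsHaarMeasure] [ν'.IsMulRightInvariant]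
  (hν : ν' = (Measure.pi ν'w).map (archPiEquivCM 3 L (Matrix.diagonal β)).symm)
  (t : ∀ w : {w : InfinitePlace L // IsComplex w}, Measure ↥(chartTorusGLoc L β w S)) [∀ w, (t w).IsHaarMeasure] [∀ w, (t w).IsInvInvariant]

/-- The inverse of Mathlib's `piEquivPiSubtypeProd`, read componentwise (definitional). [cite: BorelJacquet1979, §4.1] -/
private theorem piEquivPiSubtypeProd_symm_apply_dite {ι : Type*} (π : ι → Type*) [∀ i, MeasurableSpace (π i)] (q : ι → Prop)
    [DecidablePred q] (a : ∀ i : Subtype q, π i) (b : ∀ i : {i // ¬ q i}, π i) (i : ι) :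
    (MeasurableEquiv.piEquivPiSubtypeProd π q).symm (a, b) i = if h : q i then a ⟨i, h⟩ else b ⟨i, h⟩ := rfl

include hν in
/-- **«hβ» — THE `β`-SIDE TENSOR READING OF THE EP ASSEMBLY AT EVERY PARTNER POINT** (the binder `hβ` of ★ E3-CORE `stableSumG_eq_inv_pow_mul_of_readings` with
`m w := mcl w (bzClassMapG S c w)`, `g w := chartOrbGLoc_w(f_w)` and the displayed `¬p`-block reading `R_β`).  For the per-ball test function
`f(k) = (Π_{w : p} mcl_w(bzClassG L β k w) · f_w(k_w)) · G(cl_p k, k_{¬p})` on a frame `β` (`β_i ≠ 0`), an admissible label `S` avoided by the block `p`, a `G`-regular `c` and `ρ ∈ partnerPerms S`: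
`orbFamGExt β ν′ f S (ρ·c) ∕ archRG S (ρ·c) = (Π_{w : p} mcl_w(bzClassMapG S c w) · chartOrbGLoc L β w S ν′_w f_w (c_w ∘ ρ_w)) · ((Π_{w′ : ¬p} t_{w′}(B′_{w′})) · ∫ G(bzClassMapG S c|_p, (ḃ γ_{w′}(c_{w′} ∘ ρ_{w′}) ḃ⁻¹)_{w′}))`.
[cite: Rogawski1990, §4.1 (4.1.1) p. 39; §8.2 p. 122; §14.2 (14.2.1) p. 232] [cite: Shelstad1979, Lemma 4.2 p. 23] [cite: BorelJacquet1979, §4.1] -/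
theorem orbFamGExt_div_archRG_slotPerm_eq_of_tensor (hβ0 : ∀ i, β i ≠ 0) (hS' : ∀ w, w ∈ S → w ∈ splitChartPlaces L β)
    (hS : ∀ w, p w → w ∉ S) {c : {w : InfinitePlace L // IsComplex w} → Fin 3 → ℝ} (hc : c ∈ ArchCartan.RegG S)
    {f : ↥(arch (↥(maximalRealSubfield L)) L (IsCMField.complexConj L) 3 (Matrix.diagonal β)) → ℂ} (hfc : Continuous f) (hfs : HasCompactSupport f)
    (mcl : {w : {w : InfinitePlace L // IsComplex w} // p w} → ℂ × ℂ × ℂ → ℂ) (hmcl : ∀ w, Continuous (mcl w))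
    (fw : ∀ w : {w : {w : InfinitePlace L // IsComplex w} // p w}, ↥(archLocal L 3 (Matrix.diagonal β) w.1) → ℂ) (hfw : ∀ w, Measurable (fw w))
    (G : ({w : {w : InfinitePlace L // IsComplex w} // p w} → ℂ × ℂ × ℂ) →
      (∀ w' : {w : {w : InfinitePlace L // IsComplex w} // ¬ p w}, ↥(archLocal L 3 (Matrix.diagonal β) w'.1)) → ℂ)
    (hf : ∀ k, f k = (∏ w : {w : {w : InfinitePlace L // IsComplex w} // p w}, mcl w (bzClassG L β k w.1) * fw w (archPiEquivCM 3 L (Matrix.diagonal β) k w.1)) *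
      G (fun w => bzClassG L β k w.1) (fun w' => archPiEquivCM 3 L (Matrix.diagonal β) k w'.1)) :
    ∀ ρ ∈ partnerPerms S,
      orbFamGExt L β ν' f S (slotPerm ρ c) / archRG S (slotPerm ρ c) =
        (∏ w : {w : {w : InfinitePlace L // IsComplex w} // p w},
            mcl w (bzClassMapG S c w.1) * chartOrbGLoc L β w.1 S (ν'w w.1) (fw w) (c w.1 ∘ ⇑(ρ w.1))) *
          ((∏ w' : {w : {w : InfinitePlace L // IsComplex w} // ¬ p w}, ((t w'.1 (chartBoxImgGLoc L β w'.1 S)).toReal : ℂ)) *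
            ∫ b' : (∀ w' : {w : {w : InfinitePlace L // IsComplex w} // ¬ p w}, ↥(archLocal L 3 (Matrix.diagonal β) w'.1) ⧸ chartTorusGLoc L β w'.1 S),
              G (fun w => bzClassMapG S c w.1)
                (fun w' => descConj (gprimeBlockAt L β w'.1 S (fun i => c w'.1 (ρ w'.1 i))) (chartTorusGLoc L β w'.1 S)
                  (forall_mem_chartTorusGLoc_comm L β w'.1 S (fun i => c w'.1 (ρ w'.1 i))) id (b' w'))
              ∂(Measure.pi fun w' : {w : {w : InfinitePlace L // IsComplex w} // ¬ p w} =>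
                  quotientMeasure (chartTorusGLoc L β w'.1 S) (t w'.1) (isClosed_chartTorusGLoc L β w'.1 S) (ν'w w'.1))) := by
  intro ρ hρ
  -- abbreviations
  set e := archPiEquivCM 3 L (Matrix.diagonal β) with he
  set PEP := MeasurableEquiv.piEquivPiSubtypeProd (fun w : {w : InfinitePlace L // IsComplex w} => ↥(archLocal L 3 (Matrix.diagonal β) w)) p with hPEP
  have hc' : slotPerm ρ c ∈ ArchCartan.RegG S := (slotPerm_mem_regG_iff hρ c).2 hc
  have hcl : ∀ w, bzClassMapG S (slotPerm ρ c) w = bzClassMapG S c w := fun w => congrFun (bzClassMapG_slotPerm L hρ c) w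
  -- LHS = the chart functional at the partner point
  rw [orbFamGExt_of_mem_regG_of_admissible L β ν' f S hS' hc', mul_div_cancel_left₀ _ (archRG_ne_zero_of_mem_regG hc')]
  -- the one-place factors `b_w := (mcl_w ∘ cl_w) · f_w` and the coupling `u := G(cl_p ·, ·_{¬p})`
  set bw : ∀ w : {w : {w : InfinitePlace L // IsComplex w} // p w}, ↥(archLocal L 3 (Matrix.diagonal β) w.1) → ℂ :=
    fun w x => mcl w (bzClassG L β (e.symm (Pi.mulSingle w.1 x)) w.1) * fw w x with hbw_def
  set u : ↥(arch (↥(maximalRealSubfield L)) L (IsCMField.complexConj L) 3 (Matrix.diagonal β)) → ℂ :=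
    fun k => G (fun w => bzClassG L β k w.1) (fun w' => e k w'.1) with hu_def
  have hbw : ∀ w, Measurable (bw w) := by
    intro w
    have hcont : Continuous fun x : ↥(archLocal L 3 (Matrix.diagonal β) w.1) => bzClassG L β (e.symm (Pi.mulSingle w.1 x)) w.1 :=
      (continuous_apply w.1).comp ((continuous_bzClassG L β).comp (e.symm.continuous.comp (continuous_mulSingle w.1)))
    exact ((hmcl w).comp hcont).measurable.mul (hfw w)
  -- the tensor shape in the product coordinates
  have hf' : ∀ (x : ∀ w : {w : {w : InfinitePlace L // IsComplex w} // p w}, ↥(archLocal L 3 (Matrix.diagonal β) w.1))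
      (y : ∀ w' : {w : {w : InfinitePlace L // IsComplex w} // ¬ p w}, ↥(archLocal L 3 (Matrix.diagonal β) w'.1)),
      f (e.symm (PEP.symm (x, y))) = (∏ w, bw w (x w)) * u (e.symm (PEP.symm (x, y))) := by
    intro x y
    rw [hf]
    refine congrArg₂ (· * ·) (Finset.prod_congr rfl fun w _ => ?_) rfl
    rw [hbw_def, bzClassG_symm_piEquiv_eq_mulSingle L β p x y w]
    congr 2
    rw [he, ContinuousMulEquiv.apply_symm_apply, hPEP, piEquivPiSubtypeProd_symm_apply_dite, dif_pos w.2]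
  -- the coupling ignores conjugations inside the `p`-block
  have hu' : ∀ (g : ∀ w : {w : {w : InfinitePlace L // IsComplex w} // p w}, ↥(archLocal L 3 (Matrix.diagonal β) w.1))
      (y : ∀ w' : {w : {w : InfinitePlace L // IsComplex w} // ¬ p w}, ↥(archLocal L 3 (Matrix.diagonal β) w'.1)),
      u (e.symm (PEP.symm (fun w => g w * gprimeBlockAt L β w.1 S (slotPerm ρ c w.1) * (g w)⁻¹, y))) =
        u (e.symm (PEP.symm (fun w => gprimeBlockAt L β w.1 S (slotPerm ρ c w.1), y))) := by
    intro g y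
    simp only [hu_def]
    refine congrArg₂ G (funext fun w => ?_) (funext fun w' => ?_)
    · rw [bzClassG_symm_piEquiv_eq_mulSingle L β p _ y w, bzClassG_symm_piEquiv_eq_mulSingle L β p _ y w, bzClassG_symm_mulSingle_conj]
    · rw [he, ContinuousMulEquiv.apply_symm_apply, ContinuousMulEquiv.apply_symm_apply, hPEP, piEquivPiSubtypeProd_symm_apply_dite,
        piEquivPiSubtypeProd_symm_apply_dite, dif_neg w'.2, dif_neg w'.2]
  -- ★ (F1′)
  rw [chartOrbG_eq_prod_chartOrbGLoc_mul_of_tensor L β S ν'w p ν' hν t hβ0 hS' hS hc' hfc hfs bw hbw u hf' hu']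
  refine congrArg₂ (· * ·) (Finset.prod_congr rfl fun w _ => ?_) (congrArg₂ (· * ·) rfl ?_)
  · -- a `p`-place: class pull-out, class value, partner slot
    rw [hbw_def, chartOrbGLoc_bzClassG_mul L β w.1 S (ν'w w.1) (mcl w) (fw w) (slotPerm ρ c w.1),
      bzClassG_symm_mulSingle_gprimeBlockAt L β hS' (slotPerm ρ c) w.1, hcl]
    rfl
  · -- the `¬p`-block: the classes of the `p`-block are frozen at `bzClassMapG S c`
    refine integral_congr_ae (Filter.Eventually.of_forall fun b' => ?_)
    simp only [hu_def]
    refine congrArg₂ G (funext fun w => ?_) (funext fun w' => ?_)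
    · rw [bzClassG_symm_piEquiv_eq_mulSingle L β p _ _ w, bzClassG_symm_mulSingle_gprimeBlockAt L β hS' (slotPerm ρ c) w.1, hcl]
    · rw [he, ContinuousMulEquiv.apply_symm_apply, piEquivPiSubtypeProd_symm_apply_dite, dif_neg w'.2]
      rfl


include hν in
/-- **ED. 2 (LH3-p03 (g8), append-only; author's statement and proof VERBATIM up to ONE binder): the same `hβ` reading with the class multipliers only MEASURABLE**
(`hmcl : ∀ w, Measurable (mcl w)` — the proof uses `hmcl` solely for the measurability of the one-place factor `(mcl_w ∘ cl_w) · f_w`).  Needed by the (BI)-dock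
`ballIdentity_of_coupling`, whose consumer ★ (G1) p852328 binds the inline weight `2F∕h` with the factor's support only in the OPEN generator ball (`F z ≠ 0 → dist z y < ε`),
under which `2F∕h` is measurable but need not be continuous at the sphere. [cite: Rogawski1990, §4.1 (4.1.1) p. 39; §8.2 p. 122; §14.2 (14.2.1) p. 232] [cite: Shelstad1979, Lemma 4.2 p. 23]
[cite: BorelJacquet1979, §4.1] -/
theorem orbFamGExt_div_archRG_slotPerm_eq_of_tensor_of_measurable (hβ0 : ∀ i, β i ≠ 0) (hS' : ∀ w, w ∈ S → w ∈ splitChartPlaces L β)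
    (hS : ∀ w, p w → w ∉ S) {c : {w : InfinitePlace L // IsComplex w} → Fin 3 → ℝ} (hc : c ∈ ArchCartan.RegG S)
    {f : ↥(arch (↥(maximalRealSubfield L)) L (IsCMField.complexConj L) 3 (Matrix.diagonal β)) → ℂ} (hfc : Continuous f) (hfs : HasCompactSupport f)
    (mcl : {w : {w : InfinitePlace L // IsComplex w} // p w} → ℂ × ℂ × ℂ → ℂ) (hmcl : ∀ w, Measurable (mcl w))
    (fw : ∀ w : {w : {w : InfinitePlace L // IsComplex w} // p w}, ↥(archLocal L 3 (Matrix.diagonal β) w.1) → ℂ) (hfw : ∀ w, Measurable (fw w))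
    (G : ({w : {w : InfinitePlace L // IsComplex w} // p w} → ℂ × ℂ × ℂ) →
      (∀ w' : {w : {w : InfinitePlace L // IsComplex w} // ¬ p w}, ↥(archLocal L 3 (Matrix.diagonal β) w'.1)) → ℂ)
    (hf : ∀ k, f k = (∏ w : {w : {w : InfinitePlace L // IsComplex w} // p w}, mcl w (bzClassG L β k w.1) * fw w (archPiEquivCM 3 L (Matrix.diagonal β) k w.1)) *
      G (fun w => bzClassG L β k w.1) (fun w' => archPiEquivCM 3 L (Matrix.diagonal β) k w'.1)) :
    ∀ ρ ∈ partnerPerms S,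
      orbFamGExt L β ν' f S (slotPerm ρ c) / archRG S (slotPerm ρ c) =
        (∏ w : {w : {w : InfinitePlace L // IsComplex w} // p w},
            mcl w (bzClassMapG S c w.1) * chartOrbGLoc L β w.1 S (ν'w w.1) (fw w) (c w.1 ∘ ⇑(ρ w.1))) *
          ((∏ w' : {w : {w : InfinitePlace L // IsComplex w} // ¬ p w}, ((t w'.1 (chartBoxImgGLoc L β w'.1 S)).toReal : ℂ)) *
            ∫ b' : (∀ w' : {w : {w : InfinitePlace L // IsComplex w} // ¬ p w}, ↥(archLocal L 3 (Matrix.diagonal β) w'.1) ⧸ chartTorusGLoc L β w'.1 S),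
              G (fun w => bzClassMapG S c w.1)
                (fun w' => descConj (gprimeBlockAt L β w'.1 S (fun i => c w'.1 (ρ w'.1 i))) (chartTorusGLoc L β w'.1 S)
                  (forall_mem_chartTorusGLoc_comm L β w'.1 S (fun i => c w'.1 (ρ w'.1 i))) id (b' w'))
              ∂(Measure.pi fun w' : {w : {w : InfinitePlace L // IsComplex w} // ¬ p w} =>
                  quotientMeasure (chartTorusGLoc L β w'.1 S) (t w'.1) (isClosed_chartTorusGLoc L β w'.1 S) (ν'w w'.1))) := by
  intro ρ hρ
  -- abbreviations
  set e := archPiEquivCM 3 L (Matrix.diagonal β) with he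
  set PEP := MeasurableEquiv.piEquivPiSubtypeProd (fun w : {w : InfinitePlace L // IsComplex w} => ↥(archLocal L 3 (Matrix.diagonal β) w)) p with hPEP
  have hc' : slotPerm ρ c ∈ ArchCartan.RegG S := (slotPerm_mem_regG_iff hρ c).2 hc
  have hcl : ∀ w, bzClassMapG S (slotPerm ρ c) w = bzClassMapG S c w := fun w => congrFun (bzClassMapG_slotPerm L hρ c) w
  -- LHS = the chart functional at the partner point
  rw [orbFamGExt_of_mem_regG_of_admissible L β ν' f S hS' hc', mul_div_cancel_left₀ _ (archRG_ne_zero_of_mem_regG hc')]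
  -- the one-place factors `b_w := (mcl_w ∘ cl_w) · f_w` and the coupling `u := G(cl_p ·, ·_{¬p})`
  set bw : ∀ w : {w : {w : InfinitePlace L // IsComplex w} // p w}, ↥(archLocal L 3 (Matrix.diagonal β) w.1) → ℂ :=
    fun w x => mcl w (bzClassG L β (e.symm (Pi.mulSingle w.1 x)) w.1) * fw w x with hbw_def
  set u : ↥(arch (↥(maximalRealSubfield L)) L (IsCMField.complexConj L) 3 (Matrix.diagonal β)) → ℂ :=
    fun k => G (fun w => bzClassG L β k w.1) (fun w' => e k w'.1) with hu_def
  have hbw : ∀ w, Measurable (bw w) := by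
    intro w
    have hcont : Continuous fun x : ↥(archLocal L 3 (Matrix.diagonal β) w.1) => bzClassG L β (e.symm (Pi.mulSingle w.1 x)) w.1 :=
      (continuous_apply w.1).comp ((continuous_bzClassG L β).comp (e.symm.continuous.comp (continuous_mulSingle w.1)))
    exact ((hmcl w).comp hcont.measurable).mul (hfw w)
  -- the tensor shape in the product coordinates
  have hf' : ∀ (x : ∀ w : {w : {w : InfinitePlace L // IsComplex w} // p w}, ↥(archLocal L 3 (Matrix.diagonal β) w.1))
      (y : ∀ w' : {w : {w : InfinitePlace L // IsComplex w} // ¬ p w}, ↥(archLocal L 3 (Matrix.diagonal β) w'.1)),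
      f (e.symm (PEP.symm (x, y))) = (∏ w, bw w (x w)) * u (e.symm (PEP.symm (x, y))) := by
    intro x y
    rw [hf]
    refine congrArg₂ (· * ·) (Finset.prod_congr rfl fun w _ => ?_) rfl
    rw [hbw_def, bzClassG_symm_piEquiv_eq_mulSingle L β p x y w]
    congr 2
    rw [he, ContinuousMulEquiv.apply_symm_apply, hPEP, piEquivPiSubtypeProd_symm_apply_dite, dif_pos w.2]
  -- the coupling ignores conjugations inside the `p`-block
  have hu' : ∀ (g : ∀ w : {w : {w : InfinitePlace L // IsComplex w} // p w}, ↥(archLocal L 3 (Matrix.diagonal β) w.1))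
      (y : ∀ w' : {w : {w : InfinitePlace L // IsComplex w} // ¬ p w}, ↥(archLocal L 3 (Matrix.diagonal β) w'.1)),
      u (e.symm (PEP.symm (fun w => g w * gprimeBlockAt L β w.1 S (slotPerm ρ c w.1) * (g w)⁻¹, y))) =
        u (e.symm (PEP.symm (fun w => gprimeBlockAt L β w.1 S (slotPerm ρ c w.1), y))) := by
    intro g y
    simp only [hu_def]
    refine congrArg₂ G (funext fun w => ?_) (funext fun w' => ?_)
    · rw [bzClassG_symm_piEquiv_eq_mulSingle L β p _ y w, bzClassG_symm_piEquiv_eq_mulSingle L β p _ y w, bzClassG_symm_mulSingle_conj]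
    · rw [he, ContinuousMulEquiv.apply_symm_apply, ContinuousMulEquiv.apply_symm_apply, hPEP, piEquivPiSubtypeProd_symm_apply_dite,
        piEquivPiSubtypeProd_symm_apply_dite, dif_neg w'.2, dif_neg w'.2]
  -- ★ (F1′)
  rw [chartOrbG_eq_prod_chartOrbGLoc_mul_of_tensor L β S ν'w p ν' hν t hβ0 hS' hS hc' hfc hfs bw hbw u hf' hu']
  refine congrArg₂ (· * ·) (Finset.prod_congr rfl fun w _ => ?_) (congrArg₂ (· * ·) rfl ?_)
  · -- a `p`-place: class pull-out, class value, partner slot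
    rw [hbw_def, chartOrbGLoc_bzClassG_mul L β w.1 S (ν'w w.1) (mcl w) (fw w) (slotPerm ρ c w.1),
      bzClassG_symm_mulSingle_gprimeBlockAt L β hS' (slotPerm ρ c) w.1, hcl]
    rfl
  · -- the `¬p`-block: the classes of the `p`-block are frozen at `bzClassMapG S c`
    refine integral_congr_ae (Filter.Eventually.of_forall fun b' => ?_)
    simp only [hu_def]
    refine congrArg₂ G (funext fun w => ?_) (funext fun w' => ?_)
    · rw [bzClassG_symm_piEquiv_eq_mulSingle L β p _ _ w, bzClassG_symm_mulSingle_gprimeBlockAt L β hS' (slotPerm ρ c) w.1, hcl]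
    · rw [he, ContinuousMulEquiv.apply_symm_apply, piEquivPiSubtypeProd_symm_apply_dite, dif_neg w'.2]
      rfl

end HBeta

end Literature.NumberTheory.Rogawski1990

end
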